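import Literature.Geometry.Lorentzian.KerrSchildTruncatedCurrent
import Summits.FinalStateConjecture.FinalStateConjecture.Theorems.ClusterCompletenessAdiabaticMultiKerrILEDHardyCurrent
import Summits.FinalStateConjecture.FinalStateConjecture.Theorems.ClusterCompletenessAdiabaticMultiKerrILEDTailsCutStationary

/-!
# Crux `AdiabaticMultiKerrILED` (line `Sketch`) — divergence of the total Morawetz current of the
# tails-cut Schwarzschild zone

Helper file for the crux `stmt-FinalStateConjecture-14310`
(`Summit.FinalStateConjecture.FinalStateConjecture.Theses.ClusterCompleteness.AdiabaticMultiKerrILED`),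
line `Sketch`, stub `sum_fderiv_morawetzTotalCurrent` (lead c7, wave 5, Morawetz integration).

Setting (one zone, zero spin, rest frame): the coefficient field is the tails-cut Kerr–Schild field
`G₀ = η⁻¹ − μ ℓ♯ ⊗ ℓ♯ = KerrSchild.inverseMetric μ (Kerr.nullVector 0)` with the profile
`μ(y) = χ(r) · 2H`, `χ(r) = Real.smoothTransition (2 − r/(8M))`, `r = Kerr.radius 0 y = ‖y⃗‖`,
`H = M/r` (the static metric `−f dT² + dr²/f + r² dΩ²`, `f = 1 − μ`, in ingoing coordinates;
`∂_{r*} = f (y⃗/r)·∇ + μ ∂₀`). The TOTAL CURRENT of the degenerate Morawetz estimate is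
`J_tot = J^X + ¼ L^{ϖ₂} + J_H + J^T` with

* the radial multiplier `X = F(r) ∂_{r*}`, `F = 1 − 3M/r` (`KerrSchild.multiplierCurrent`),
* the Lagrangian correction of weight `ϖ₂(r) = 2 (1 − 2M/r) ((2r − 3M)/r² − M³ (r − 3M)²/r⁶)`
  (`KerrSchild.lagrangianCurrent`, tree convention `¼ · lagrangianCurrent`),
* the Hardy current `J_H^μ = ½ ŷ(r) Φ² (∂_{r*})^μ`, `ŷ(s) = 2 (7M − s)² q_θ(s/M)/(M³ s)` for
  `s ≤ 7M` and `0` beyond (`q_θ` an explicit quintic),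
* the Killing current `J^T` of `T = ∂₀ = KerrSchild.timeField`.

This file proves the **pointwise divergence identity** at a point `x` with `r(x) > 2M` where `Φ`
is `C²` and `□_{G₀} Φ (x) = 0`:

`∑_μ ∂_μ J_tot^μ = K^X + ¼ ϖ₂ G₀(dΦ, dΦ) − ⅛ (□_{G₀} ϖ₂) Φ² + [ŷ Φ ∂_{r*}Φ + ½ Φ² r⁻² (r² f ŷ)′]`

(`sum_fderiv_morawetzTotalCurrent`). The four pieces: `J^X + ¼ L` by
`KerrSchild.sum_fderiv_modifiedCurrent` (DRSR arXiv:1402.7034, §2.3.1: source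
`(X(Φ) + ¼ ϖ₂ Φ) □Φ = 0` plus bulk), `J_H` by `sum_fderiv_hardyCurrent_tailsCut`, and `J^T` by
`KerrSchild.sum_fderiv_multiplierCurrent` with `□Φ = 0` and `K^T = 0` (stationarity,
`fderiv_tailsCut_inverseMetric_basisVector_zero`). The abstract form is
`morawetzTotal_sum_fderiv_abstract`; the only analytic input beyond the landed bricks is the
differentiability of the glued Hardy weight `ŷ` (double zero at `s = 7M`,
`morawetzTotal_differentiableAt_hardyWeight`). Dafermos–Rodnianski arXiv:0811.0354, §4.1.1;
Dafermos–Rodnianski–Shlapentokh-Rothman arXiv:1402.7034, §2.3.1–§2.3.2. [folklore]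
-/

noncomputable section

-- the doubled `FinalStateConjecture.FinalStateConjecture` path component trips dupNamespace
set_option linter.dupNamespace false

open Set Filter
open scoped BigOperators Topology ContDiff
open Literature.Geometry.Lorentzian

namespace Summit.FinalStateConjecture.FinalStateConjecture.Theorems

/-! ### The glued Hardy weight is differentiable -/

/-- **Glueing a `C¹` branch to zero with a double zero.** For `f = (s ↦ if s ≤ c then g s else 0)`:
`f` is differentiable at `s` provided `g` is differentiable at `s` when `s ≤ c`, `g c = 0`, and
`g` has derivative `0` at `c` when `s = c` (left branch `g`, right branch `0`, matching value and
derivative at the junction: `HasDerivWithinAt.union` on `Iic c ∪ Ici c`). [folklore] -/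
theorem morawetzTotal_differentiableAt_ite_le {g : ℝ → ℝ} {c s : ℝ}
    (hg : s ≤ c → DifferentiableAt ℝ g s) (hc : g c = 0) (hc' : s = c → HasDerivAt g 0 c) :
    DifferentiableAt ℝ (fun t ↦ if t ≤ c then g t else 0) s := by
  rcases lt_trichotomy s c with h | rfl | h
  · -- left of the junction: locally `g`
    have heq : (fun t ↦ if t ≤ c then g t else 0) =ᶠ[𝓝 s] g := by
      filter_upwards [Iio_mem_nhds h] with t ht
      rw [if_pos (le_of_lt ht)]
    exact (hg h.le).congr_of_eventuallyEq heq
  · -- the junction: one-sided derivatives `0` on both sides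
    have hL : HasDerivWithinAt (fun t ↦ if t ≤ s then g t else 0) 0 (Iic s) s :=
      (hc' rfl).hasDerivWithinAt.congr (fun t ht ↦ by rw [if_pos (mem_Iic.mp ht)])
        (by rw [if_pos le_rfl])
    have hR : HasDerivWithinAt (fun t ↦ if t ≤ s then g t else 0) 0 (Ici s) s := by
      refine (hasDerivWithinAt_const s (Ici s) (0 : ℝ)).congr (fun t ht ↦ ?_) ?_
      · by_cases hts : t ≤ s
        · rw [if_pos hts, le_antisymm hts (mem_Ici.mp ht), hc]
        · rw [if_neg hts]
      · rw [if_pos le_rfl, hc]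
    have hU := hL.union hR
    rw [Iic_union_Ici, hasDerivWithinAt_univ] at hU
    exact hU.differentiableAt
  · -- right of the junction: locally `0`
    have heq : (fun t ↦ if t ≤ c then g t else 0) =ᶠ[𝓝 s] fun _ ↦ (0 : ℝ) := by
      filter_upwards [Ioi_mem_nhds h] with t ht
      rw [if_neg (not_le.mpr ht)]
    exact (differentiableAt_const (0 : ℝ)).congr_of_eventuallyEq heq

/-- **The Hardy weight `ŷ(s) = 2 (7M − s)² q(s/M)/(M³ s)` (`s ≤ 7M`), `0` (`s > 7M`) is
differentiable on `{s > 0}`** for every differentiable `q` and `M > 0`: the branch is smooth off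
`s = 0` and has a double zero at `s = 7M`. [folklore] -/
theorem morawetzTotal_differentiableAt_hardyWeight {q : ℝ → ℝ} (hq : Differentiable ℝ q) {M s : ℝ}
    (hM : 0 < M) (hs : 0 < s) :
    DifferentiableAt ℝ
      (fun s ↦ if s ≤ 7 * M then 2 * (7 * M - s) ^ 2 * q (s / M) / (M ^ 3 * s) else 0) s := by
  have hM0 : M ≠ 0 := hM.ne'
  have hqc : ∀ t, DifferentiableAt ℝ (fun t ↦ q (t / M)) t := fun t ↦
    (hq (t / M)).comp t (differentiableAt_id.div_const M)
  refine morawetzTotal_differentiableAt_ite_le (fun _ ↦ ?_) (by simp) ?_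
  · have hs0 : M ^ 3 * s ≠ 0 := by positivity
    exact (((differentiableAt_const _).mul
      (((differentiableAt_const _).sub differentiableAt_id).pow 2)).mul (hqc s)).div
      ((differentiableAt_const _).mul differentiableAt_id) hs0
  · rintro rfl
    have h7 : M ^ 3 * (7 * M) ≠ 0 := by positivity
    have hk : DifferentiableAt ℝ (fun t ↦ 2 * q (t / M) / (M ^ 3 * t)) (7 * M) :=
      (((differentiableAt_const _).mul (hqc _))).div
        ((differentiableAt_const _).mul differentiableAt_id) h7
    have hu : HasDerivAt (fun t ↦ (7 * M - t) ^ 2)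
        (((2 : ℕ) : ℝ) * (7 * M - 7 * M) ^ (2 - 1) * -1) (7 * M) :=
      ((hasDerivAt_id' (7 * M)).const_sub (7 * M)).pow 2
    have hfun : (fun t ↦ 2 * (7 * M - t) ^ 2 * q (t / M) / (M ^ 3 * t)) =
        fun t ↦ (7 * M - t) ^ 2 * (2 * q (t / M) / (M ^ 3 * t)) := by
      funext t
      ring
    rw [hfun]
    refine (hu.mul hk.hasDerivAt).congr_deriv ?_
    simp

/-! ### The abstract divergence identity -/

/-- **Divergence of the total current, abstract form.** For a coefficient field `G` which is `C¹`,
symmetric and stationary (`∂₀ G^{αβ} = 0`) at `x`, a `C¹` multiplier `X`, `C²` weight `ϖ` and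
function `w` with `□_G w (x) = 0`, and any extra current `H` differentiable at `x` with
`∑_μ ∂_μ H^μ (x) = S`:
`∑_μ ∂_μ (J^X + ¼ L^ϖ + H + J^T)^μ = K^X + ¼ ϖ Q − ⅛ (□_G ϖ) w² + S`
(`KerrSchild.sum_fderiv_modifiedCurrent` for `J^X + ¼ L`, whose source `(X(w) + ¼ ϖ w) □w`
vanishes; `KerrSchild.sum_fderiv_multiplierCurrent` for `J^T`, whose source `□w ∂₀w` vanishes and
whose bulk `K^T = −½ ∂₀G(dw, dw)` vanishes by stationarity). DRSR arXiv:1402.7034, §2.3.1–§2.3.2.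
[folklore] -/
theorem morawetzTotal_sum_fderiv_abstract {G : E4 → Fin 4 → Fin 4 → ℝ} {X : E4 → Fin 4 → ℝ}
    {ϖ w : E4 → ℝ} {H : Fin 4 → E4 → ℝ} {x : E4} {S : ℝ}
    (hG : ∀ μ ν, ContDiffAt ℝ 1 (fun y ↦ G y μ ν) x) (hsymm : ∀ μ ν, G x μ ν = G x ν μ)
    (hstat : ∀ α β, fderiv ℝ (fun y ↦ G y α β) x (E4.basisVector 0) = 0)
    (hX : ∀ α, ContDiffAt ℝ 1 (fun y ↦ X y α) x) (hϖ : ContDiffAt ℝ 2 ϖ x)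
    (hw : ContDiffAt ℝ 2 w x) (hH : ∀ μ, DifferentiableAt ℝ (H μ) x)
    (hS : ∑ μ, fderiv ℝ (H μ) x (E4.basisVector μ) = S)
    (hwave : KerrSchild.waveOperator G w x = 0) :
    ∑ μ, fderiv ℝ (fun y ↦ KerrSchild.multiplierCurrent G X w y μ +
        4⁻¹ * KerrSchild.lagrangianCurrent G ϖ w y μ + H μ y +
        KerrSchild.multiplierCurrent G KerrSchild.timeField w y μ) x (E4.basisVector μ) =
      KerrSchild.multiplierBulk G X w x +
        4⁻¹ * (ϖ x * ∑ α, ∑ β, G x α β * fderiv ℝ w x (E4.basisVector α) *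
          fderiv ℝ w x (E4.basisVector β)) -
        8⁻¹ * KerrSchild.waveOperator G ϖ x * w x ^ 2 + S := by
  have hG1 : ∀ μ ν, DifferentiableAt ℝ (fun y ↦ G y μ ν) x := fun μ ν ↦
    (hG μ ν).differentiableAt one_ne_zero
  have hX1 : ∀ α, DifferentiableAt ℝ (fun y ↦ X y α) x := fun α ↦
    (hX α).differentiableAt one_ne_zero
  have hT : ∀ α, ContDiffAt ℝ 1 (fun y ↦ KerrSchild.timeField y α) x := fun α ↦
    (KerrSchild.contDiff_timeField α).contDiffAt
  have hT1 : ∀ α, DifferentiableAt ℝ (fun y ↦ KerrSchild.timeField y α) x := fun α ↦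
    (hT α).differentiableAt one_ne_zero
  -- differentiability of the four pieces at `x`
  have hJ : ∀ μ, DifferentiableAt ℝ (fun y ↦ KerrSchild.multiplierCurrent G X w y μ) x := fun μ ↦
    (KerrSchild.contDiffAt_multiplierCurrent hG hX hw μ).differentiableAt one_ne_zero
  have hL : ∀ μ, DifferentiableAt ℝ (fun y ↦ KerrSchild.lagrangianCurrent G ϖ w y μ) x := fun μ ↦
    (KerrSchild.contDiffAt_lagrangianCurrent hG hϖ hw μ).differentiableAt one_ne_zero
  have hJT : ∀ μ, DifferentiableAt ℝ
      (fun y ↦ KerrSchild.multiplierCurrent G KerrSchild.timeField w y μ) x := fun μ ↦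
    (KerrSchild.contDiffAt_multiplierCurrent hG hT hw μ).differentiableAt one_ne_zero
  -- Leibniz: split the derivative of the sum
  have hsplit : ∀ μ, fderiv ℝ (fun y ↦ KerrSchild.multiplierCurrent G X w y μ +
        4⁻¹ * KerrSchild.lagrangianCurrent G ϖ w y μ + H μ y +
        KerrSchild.multiplierCurrent G KerrSchild.timeField w y μ) x (E4.basisVector μ) =
      fderiv ℝ (fun y ↦ KerrSchild.multiplierCurrent G X w y μ +
          4⁻¹ * KerrSchild.lagrangianCurrent G ϖ w y μ) x (E4.basisVector μ) +
        fderiv ℝ (H μ) x (E4.basisVector μ) +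
        fderiv ℝ (fun y ↦ KerrSchild.multiplierCurrent G KerrSchild.timeField w y μ) x
          (E4.basisVector μ) := by
    intro μ
    have hJL : DifferentiableAt ℝ (fun y ↦ KerrSchild.multiplierCurrent G X w y μ +
        4⁻¹ * KerrSchild.lagrangianCurrent G ϖ w y μ) x := (hJ μ).add ((hL μ).const_mul _)
    have h := (hJL.hasFDerivAt.add (hH μ).hasFDerivAt).add (hJT μ).hasFDerivAt
    have h' : HasFDerivAt (fun y ↦ KerrSchild.multiplierCurrent G X w y μ +
        4⁻¹ * KerrSchild.lagrangianCurrent G ϖ w y μ + H μ y +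
        KerrSchild.multiplierCurrent G KerrSchild.timeField w y μ) _ x := h
    rw [h'.fderiv]
    simp only [add_apply]
  -- the Killing current is divergence-free for solutions: `□w ∂₀w + K^T = 0`
  have hT0 : ∑ μ, fderiv ℝ (fun y ↦ KerrSchild.multiplierCurrent G KerrSchild.timeField w y μ) x
      (E4.basisVector μ) = 0 := by
    rw [KerrSchild.sum_fderiv_multiplierCurrent hG1 hsymm hT1 hw, hwave, zero_mul, zero_add,
      KerrSchild.multiplierBulk_of_fderiv_eq_zero _ w fun α ↦ KerrSchild.fderiv_timeField α x]
    simp [Fin.sum_univ_succ, hstat]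
  simp only [hsplit, Finset.sum_add_distrib]
  rw [KerrSchild.sum_fderiv_modifiedCurrent hG1 hsymm hX1 hϖ hw, hS, hT0, hwave]
  ring

/-! ### The registered stub -/

/-- **Stub `sum_fderiv_morawetzTotalCurrent`** (crux `AdiabaticMultiKerrILED`, line `Sketch`).
Divergence of the total Morawetz current `J^X + ¼ L^{ϖ₂} + J_H + J^T` of the tails-cut
Schwarzschild zone at a point `x` with `r(x) > 2M`, for `Φ` of class `C²` at `x` with
`□_{G₀} Φ (x) = 0`:
`∑_μ ∂_μ J_tot^μ = K^X + ¼ ϖ₂ G₀(dΦ,dΦ) − ⅛ (□_{G₀} ϖ₂) Φ² + ŷ Φ ∂_{r*}Φ + ½ Φ² r⁻² (r² f ŷ)′`.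
The pieces are `C¹` at `x` since `G₀`, `X = (1 − 3M/r) ∂_{r*}`, `ϖ₂ ∘ r` are smooth on `{r > 0}`
(`contDiffAt_tailsCut_inverseMetric`, `Kerr.contDiffAt_radius`, `Kerr.contDiffAt_scalarH`) and the
glued Hardy weight is differentiable (`morawetzTotal_differentiableAt_hardyWeight`); then
`morawetzTotal_sum_fderiv_abstract` with the Hardy divergence `sum_fderiv_hardyCurrent_tailsCut`.
Dafermos–Rodnianski arXiv:0811.0354, §4.1.1; DRSR arXiv:1402.7034, §2.3.1–§2.3.2. [folklore] -/
theorem sum_fderiv_morawetzTotalCurrent : ∀ (M : ℝ) (Φ : E4 → ℝ) (x : E4), 0 < M → 2 * M < Kerr.radius 0 x → ContDiffAt ℝ 2 Φ x → KerrSchild.waveOperator (KerrSchild.inverseMetric (fun y ↦ Real.smoothTransition (2 - Kerr.radius 0 y / (8 * M)) * (2 * Kerr.scalarH M 0 y)) (Kerr.nullVector 0)) Φ x = 0 → ∑ μ, fderiv ℝ (fun y ↦ (KerrSchild.multiplierCurrent (KerrSchild.inverseMetric (fun y ↦ Real.smoothTransition (2 - Kerr.radius 0 y / (8 * M)) * (2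 * Kerr.scalarH M 0 y)) (Kerr.nullVector 0)) (fun (z : E4) (α : Fin 4) ↦ if α = 0 then (1 - 3 * M / Kerr.radius 0 z) * (Real.smoothTransition (2 - Kerr.radius 0 z / (8 * M)) * (2 * Kerr.scalarH M 0 z)) else (1 - 3 * M / Kerr.radius 0 z) * (1 - (Real.smoothTransition (2 - Kerr.radius 0 z / (8 * M)) * (2 * Kerr.scalarH M 0 z))) * z α / Kerr.radius 0 z) Φ y μ + 4⁻¹ * KerrSchild.lagrangianCurrent (KerrSchild.inverseMetric (fun y ↦ Real.smoothTransition (2 - Kerr.radius 0 y / (8 * M)) * (2 * Kerr.scalarH M 0 y)) (Kerr.nullVector 0)) (fun z ↦ (fun s ↦ 2 * ((1 - 2 * M / s) * ((2 * s - 3 * M) / s ^ 2 - M ^ 3 * (s - 3 * M) ^ 2 / s ^ 6))) (Kerr.radius 0 z)) Φ y μ + 2⁻¹ * (fun s ↦ if s ≤ 7 * M then 2 * (7 * M - s) ^ 2 * (fun ρ ↦ (-((593459 : ℝ) / 10000000)) + (788874 : ℝ) / 10000000 * ρ - (383061 : ℝ) / 10000000 * ρ ^ 2 + (92031 : ℝ)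 / 10000000 * ρ ^ 3 - (10985 : ℝ) / 10000000 * ρ ^ 4 + (525 : ℝ) / 10000000 * ρ ^ 5) (s / M) / (M ^ 3 * s) else 0) (Kerr.radius 0 y) * Φ y ^ 2 * (if μ = 0 then (Real.smoothTransition (2 - Kerr.radius 0 y / (8 * M)) * (2 * Kerr.scalarH M 0 y)) else (1 - (Real.smoothTransition (2 - Kerr.radius 0 y / (8 * M)) * (2 * Kerr.scalarH M 0 y))) * y μ / Kerr.radius 0 y) + KerrSchild.multiplierCurrent (KerrSchild.inverseMetric (fun y ↦ Real.smoothTransition (2 - Kerr.radius 0 y / (8 * M)) * (2 * Kerr.scalarH M 0 y)) (Kerr.nullVector 0)) KerrSchild.timeField Φ y μ)) x (E4.basisVector μ) = (KerrSchild.multiplierBulk (KerrSchild.inverseMetric (fun y ↦ Real.smoothTransition (2 - Kerr.radius 0 y / (8 * M)) * (2 * Kerr.scalarH M 0 y)) (Kerr.nullVector 0)) (fun (z : E4) (α : Fin 4) ↦ if α = 0 then (1 - 3 * M / Kerr.radius 0 z) * (Real.smoothTransition (2 - Kerr.radius 0 z / (8 * M)) * (2 * Kerr.scalarH M 0 z))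 else (1 - 3 * M / Kerr.radius 0 z) * (1 - (Real.smoothTransition (2 - Kerr.radius 0 z / (8 * M)) * (2 * Kerr.scalarH M 0 z))) * z α / Kerr.radius 0 z) Φ x + 4⁻¹ * ((fun s ↦ 2 * ((1 - 2 * M / s) * ((2 * s - 3 * M) / s ^ 2 - M ^ 3 * (s - 3 * M) ^ 2 / s ^ 6))) (Kerr.radius 0 x) * (∑ μ, ∑ ν, (KerrSchild.inverseMetric (fun y ↦ Real.smoothTransition (2 - Kerr.radius 0 y / (8 * M)) * (2 * Kerr.scalarH M 0 y)) (Kerr.nullVector 0)) x μ ν * fderiv ℝ Φ x (E4.basisVector μ) * fderiv ℝ Φ x (E4.basisVector ν))) - 8⁻¹ * KerrSchild.waveOperator (KerrSchild.inverseMetric (fun y ↦ Real.smoothTransition (2 - Kerr.radius 0 y / (8 * M)) * (2 * Kerr.scalarH M 0 y)) (Kerr.nullVector 0)) (fun y ↦ (fun s ↦ 2 * ((1 - 2 * M / s) * ((2 * s - 3 * M) / s ^ 2 - M ^ 3 * (s - 3 * M) ^ 2 / s ^ 6))) (Kerr.radius 0 y)) x * Φ x ^ 2 + ((fun s ↦ if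 s ≤ 7 * M then 2 * (7 * M - s) ^ 2 * (fun ρ ↦ (-((593459 : ℝ) / 10000000)) + (788874 : ℝ) / 10000000 * ρ - (383061 : ℝ) / 10000000 * ρ ^ 2 + (92031 : ℝ) / 10000000 * ρ ^ 3 - (10985 : ℝ) / 10000000 * ρ ^ 4 + (525 : ℝ) / 10000000 * ρ ^ 5) (s / M) / (M ^ 3 * s) else 0) (Kerr.radius 0 x) * Φ x * ((1 - (Real.smoothTransition (2 - Kerr.radius 0 x / (8 * M)) * (2 * Kerr.scalarH M 0 x))) * (∑ i : Fin 3, x i.succ * fderiv ℝ Φ x (E4.basisVector i.succ)) / Kerr.radius 0 x + (Real.smoothTransition (2 - Kerr.radius 0 x / (8 * M)) * (2 * Kerr.scalarH M 0 x)) * fderiv ℝ Φ x (E4.basisVector 0)) + 2⁻¹ * Φ x ^ 2 * ((Kerr.radius 0 x)⁻¹ ^ 2 * deriv (fun s ↦ s ^ 2 * (fun s ↦ 1 - Real.smoothTransition (2 - s / (8 * M)) * (2 * M / s)) s * (fun s ↦ if s ≤ 7 * M then 2 * (7 * M - s) ^ 2 * (fun ρ ↦ (-((593459 : ℝ) / 10000000))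 + (788874 : ℝ) / 10000000 * ρ - (383061 : ℝ) / 10000000 * ρ ^ 2 + (92031 : ℝ) / 10000000 * ρ ^ 3 - (10985 : ℝ) / 10000000 * ρ ^ 4 + (525 : ℝ) / 10000000 * ρ ^ 5) (s / M) / (M ^ 3 * s) else 0) s) (Kerr.radius 0 x)))) := by
  intro M Φ x hM hx hΦ hwave
  have hxpos : 0 < Kerr.radius 0 x := lt_trans (by positivity) hx
  have hr0 : Kerr.radius 0 x ≠ 0 := hxpos.ne'
  -- the coefficient field: `C¹`, symmetric, stationary at `x`
  have hG : ∀ μ ν, ContDiffAt ℝ 1 (fun y ↦ KerrSchild.inverseMetric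
      (fun z ↦ Real.smoothTransition (2 - Kerr.radius 0 z / (8 * M)) * (2 * Kerr.scalarH M 0 z))
      (Kerr.nullVector 0) y μ ν) x :=
    fun μ ν ↦ contDiffAt_tailsCut_inverseMetric M 0 hxpos μ ν (n := 1)
  have hsymm : ∀ μ ν, KerrSchild.inverseMetric
      (fun z ↦ Real.smoothTransition (2 - Kerr.radius 0 z / (8 * M)) * (2 * Kerr.scalarH M 0 z))
      (Kerr.nullVector 0) x μ ν = KerrSchild.inverseMetric
      (fun z ↦ Real.smoothTransition (2 - Kerr.radius 0 z / (8 * M)) * (2 * Kerr.scalarH M 0 z))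
      (Kerr.nullVector 0) x ν μ := fun μ ν ↦ KerrSchild.inverseMetric_symm _ _ x μ ν
  have hstat : ∀ α β, fderiv ℝ (fun y ↦ KerrSchild.inverseMetric
      (fun z ↦ Real.smoothTransition (2 - Kerr.radius 0 z / (8 * M)) * (2 * Kerr.scalarH M 0 z))
      (Kerr.nullVector 0) y α β) x (E4.basisVector 0) = 0 :=
    fun α β ↦ fderiv_tailsCut_inverseMetric_basisVector_zero M 0 x α β hxpos
  -- the radius, the profile `μ`, the multiplier `X` and the weight `ϖ₂ ∘ r` are smooth at `x`
  have hr1 : ContDiffAt ℝ 1 (Kerr.radius 0) x := Kerr.contDiffAt_radius hxpos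
  have hr2 : ContDiffAt ℝ 2 (Kerr.radius 0) x := Kerr.contDiffAt_radius hxpos
  have hprof : ContDiffAt ℝ 1 (fun z ↦
      Real.smoothTransition (2 - Kerr.radius 0 z / (8 * M)) * (2 * Kerr.scalarH M 0 z)) x :=
    (Real.smoothTransition.contDiff.contDiffAt.comp x
      (contDiffAt_const.sub (hr1.div_const _))).mul
        (contDiffAt_const.mul (Kerr.contDiffAt_scalarH M 0 hxpos))
  have hF : ContDiffAt ℝ 1 (fun z ↦ 1 - 3 * M / Kerr.radius 0 z) x :=
    contDiffAt_const.sub (contDiffAt_const.div hr1 hr0)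
  have hX : ∀ α, ContDiffAt ℝ 1 (fun z ↦ (fun (z : E4) (α : Fin 4) ↦ if α = 0 then
      (1 - 3 * M / Kerr.radius 0 z) * (Real.smoothTransition (2 - Kerr.radius 0 z / (8 * M)) *
        (2 * Kerr.scalarH M 0 z)) else (1 - 3 * M / Kerr.radius 0 z) *
      (1 - (Real.smoothTransition (2 - Kerr.radius 0 z / (8 * M)) * (2 * Kerr.scalarH M 0 z))) *
        z α / Kerr.radius 0 z) z α) x := by
    intro α
    refine Fin.cases ?_ (fun i ↦ ?_) α
    · simp only [↓reduceIte]
      exact hF.mul hprof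
    · simp only [Fin.succ_ne_zero, ↓reduceIte]
      exact ((hF.mul (contDiffAt_const.sub hprof)).mul
        (Kerr.contDiff_coord i.succ).contDiffAt).div hr1 hr0
  have hϖ : ContDiffAt ℝ 2 (fun y ↦ (fun s ↦ 2 * ((1 - 2 * M / s) *
      ((2 * s - 3 * M) / s ^ 2 - M ^ 3 * (s - 3 * M) ^ 2 / s ^ 6))) (Kerr.radius 0 y)) x := by
    have hp2 : Kerr.radius 0 x ^ 2 ≠ 0 := pow_ne_zero 2 hr0
    have hp6 : Kerr.radius 0 x ^ 6 ≠ 0 := pow_ne_zero 6 hr0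
    have h1 : ContDiffAt ℝ 2 (fun s : ℝ ↦ 2 * ((1 - 2 * M / s) *
        ((2 * s - 3 * M) / s ^ 2 - M ^ 3 * (s - 3 * M) ^ 2 / s ^ 6))) (Kerr.radius 0 x) := by
      fun_prop (disch := assumption)
    exact h1.comp x hr2
  -- the function `Φ` and the glued Hardy weight `ŷ ∘ r`
  have hΦ1 : DifferentiableAt ℝ Φ x := hΦ.differentiableAt two_ne_zero
  have hq : Differentiable ℝ (fun ρ : ℝ ↦ (-((593459 : ℝ) / 10000000)) +
      (788874 : ℝ) / 10000000 * ρ - (383061 : ℝ) / 10000000 * ρ ^ 2 +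
      (92031 : ℝ) / 10000000 * ρ ^ 3 - (10985 : ℝ) / 10000000 * ρ ^ 4 +
      (525 : ℝ) / 10000000 * ρ ^ 5) := by
    fun_prop
  have hy := morawetzTotal_differentiableAt_hardyWeight hq hM hxpos
  have hyr : DifferentiableAt ℝ (fun z ↦ (fun s ↦ if s ≤ 7 * M then 2 * (7 * M - s) ^ 2 *
      (fun ρ ↦ (-((593459 : ℝ) / 10000000)) + (788874 : ℝ) / 10000000 * ρ -
        (383061 : ℝ) / 10000000 * ρ ^ 2 + (92031 : ℝ) / 10000000 * ρ ^ 3 -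
        (10985 : ℝ) / 10000000 * ρ ^ 4 + (525 : ℝ) / 10000000 * ρ ^ 5) (s / M) / (M ^ 3 * s)
      else 0) (Kerr.radius 0 z)) x :=
    hy.comp x (hr1.differentiableAt one_ne_zero)
  have hprof1 : DifferentiableAt ℝ (fun z ↦
      Real.smoothTransition (2 - Kerr.radius 0 z / (8 * M)) * (2 * Kerr.scalarH M 0 z)) x :=
    hprof.differentiableAt one_ne_zero
  have hH : ∀ μ, DifferentiableAt ℝ (fun y ↦ 2⁻¹ * (fun s ↦ if s ≤ 7 * M then
      2 * (7 * M - s) ^ 2 * (fun ρ ↦ (-((593459 : ℝ) / 10000000)) +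
        (788874 : ℝ) / 10000000 * ρ - (383061 : ℝ) / 10000000 * ρ ^ 2 +
        (92031 : ℝ) / 10000000 * ρ ^ 3 - (10985 : ℝ) / 10000000 * ρ ^ 4 +
        (525 : ℝ) / 10000000 * ρ ^ 5) (s / M) / (M ^ 3 * s) else 0) (Kerr.radius 0 y) * Φ y ^ 2 *
      (if μ = 0 then (Real.smoothTransition (2 - Kerr.radius 0 y / (8 * M)) *
        (2 * Kerr.scalarH M 0 y)) else (1 - (Real.smoothTransition (2 - Kerr.radius 0 y / (8 * M)) *
        (2 * Kerr.scalarH M 0 y))) * y μ / Kerr.radius 0 y)) x := by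
    intro μ
    refine Fin.cases ?_ (fun i ↦ ?_) μ
    · simp only [↓reduceIte]
      exact ((hyr.const_mul _).mul (hΦ1.pow 2)).mul hprof1
    · simp only [Fin.succ_ne_zero, ↓reduceIte]
      have h1 : ContDiffAt ℝ 1 (fun z ↦ (1 - Real.smoothTransition
          (2 - Kerr.radius 0 z / (8 * M)) * (2 * Kerr.scalarH M 0 z)) * z i.succ /
          Kerr.radius 0 z) x :=
        ((contDiffAt_const.sub hprof).mul (Kerr.contDiff_coord i.succ).contDiffAt).div hr1 hr0
      exact ((hyr.const_mul _).mul (hΦ1.pow 2)).mul (h1.differentiableAt one_ne_zero)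
  -- the Hardy divergence, and the abstract identity
  have hardy := sum_fderiv_hardyCurrent_tailsCut M (fun s ↦ if s ≤ 7 * M then 2 * (7 * M - s) ^ 2 *
    (fun ρ ↦ (-((593459 : ℝ) / 10000000)) + (788874 : ℝ) / 10000000 * ρ -
      (383061 : ℝ) / 10000000 * ρ ^ 2 + (92031 : ℝ) / 10000000 * ρ ^ 3 -
      (10985 : ℝ) / 10000000 * ρ ^ 4 + (525 : ℝ) / 10000000 * ρ ^ 5) (s / M) / (M ^ 3 * s)
    else 0) Φ x hM hxpos hy hΦ1
  exact morawetzTotal_sum_fderiv_abstract hG hsymm hstat hX hϖ hΦ hH hardy hwave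

end Summit.FinalStateConjecture.FinalStateConjecture.Theorems

end
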